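import Mathlib
import HarnessLib
import Summits.HubbardSuperconductivity.HubbardSuperconductivity.Theorems.KLProgrammeKLRegimeSplitPairArrayV5
import Summits.HubbardSuperconductivity.HubbardSuperconductivity.Theorems.KLProgrammeKLRegimeSplitPairLadderExtra0

/-!
# Route `KLProgramme` — row 0′ of the K3 supplier map (child 1), GENERIC in the (T)/(D) extra family, with an ENTRY-DEPENDENT UV datum
# `|𝒞_0(Q;k,k') − U| ≤ initDevBar + X 0 Qm k k'` (pre-empting the candidate Δ-UV: the n = 0 counterterm-vertex leg dressing, T2-2 17:32Z)

Cell gate-hubbard-kl, seat hubbard-kl-k3c1-p2.  Twin of `pairArray_envelope_extra` (`…SplitPairArrayExtra`, p457160) with the scale-0 extra term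
admitted in the UV clause and in the per-entry budget (`X 0 + Σ_{i<n} X (i+1) ≤ Xtot`); ladder by `pairLadder_envelope_extra0`; everything else (frozen
part, constants, smallness) verbatim.  Since `X ≥ 0` this form also covers the current UV clause.  **`pairArray_envelope_extra0`**.  Everything is
proved; no definitions.
-/

noncomputable section

namespace Summit.HubbardSuperconductivity.HubbardSuperconductivity.Theorems.KLRegimeSplit

set_option linter.dupNamespace false -- summit = problem name (single-conjunct summit), D-0017

open Finset Literature.MathematicalPhysics.QuantumLattice Literature.Probability.LatticeModels
open Summit.HubbardSuperconductivity.HubbardSuperconductivity.Theorems.KLProgrammeLegKernels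
open Summit.HubbardSuperconductivity.HubbardSuperconductivity.Theorems.CooperChannelRiccatiFlow
open Summit.HubbardSuperconductivity.HubbardSuperconductivity.Theorems.SWaveCascade

section Model

variable (L M : ℕ) [NeZero L] [NeZero M]

variable {G : GeoConsts} {P : SplitConsts} {Qc : EngConsts}

set_option maxHeartbeats 400000 in -- ≈ 170-line proof (copy of `pairArray_envelope_v5`'s architecture); pre-empted per the cell's heartbeat rule
/-- **Row 0′, every total momentum, generic in the extra family, entry-dependent UV datum.**  Data at fixed `L M G P Q β U μ K` and `n` (the `n ≤ n_β` of the instances enters only through `Xtot`): an extra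
majorant `X j Qm k k' ≥ 0` with `X j Qm k k' ≤ Xsup` (every scale) and `Σ_{j ∈ (t,n]} X j Qm k k' ≤ Xtot`, `Σ_{i<n} X (i+1) Qm k k' ≤ Xtot`
(every entry, the scale-0 term included); the UV clause `|𝒞_0(Q;k,k') − U| ≤ initDevBar + X 0`; for `1 ≤ j ≤ n` the EXPANDED ladder clause (pair class at `j`: weights
`w ≥ 0` of mass `≤ bhi`, a right inverse `N` of `1 + diag w·𝒞_{j−1}`, `|𝒞_j − 𝒞_{j−1}N| ≤ drivePBar (j−1) + ē_{j−1} + X j` on the ball) and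
the EXPANDED increment clause (`|𝒞_j − 𝒞_{j−1}| ≤ gainBar j + ē_{j−1} + X j`); the no-onset smallness
`8·20·((initDevBar + Σ_{j<n}(drivePBar+ē) + Xtot) + (Σ_{j<n}(drivePBar+ē) + Xsup))·bhi·n ≤ 1`.  THEN for every `Qm` there is `u ∈ [0, U]`
with `|𝒞_n(Q;k,k') − u| ≤ 8·((initDevBar + Σ + Xtot) + (Σ + Xsup)) + (3·CF·(Klam U)² + Xtot + Σ_{i<n} ē_i)` on the ball. -/
theorem pairArray_envelope_extra0 (hG : G.WF) (hP : P.WF) (hQc : Qc.WF) {β U μ : ℝ} {K : TrigPolyC4v} (hU : 0 ≤ U)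
    {n : ℕ} (X : ℕ → TorusSite 2 L → TorusSite 2 L → TorusSite 2 L → ℝ) {Xtot Xsup : ℝ}
    (hX0 : ∀ j Qm k k', 0 ≤ X j Qm k k') (hXtot0 : 0 ≤ Xtot) (hXsup0 : 0 ≤ Xsup)
    (hXsup : ∀ j Qm k k', X j Qm k k' ≤ Xsup)
    (hXsum : ∀ (t : ℕ) (Qm k k' : TorusSite 2 L), ∑ j ∈ Ioc t n, X j Qm k k' ≤ Xtot)
    (hXtot : ∀ Qm k k' : TorusSite 2 L, X 0 Qm k k' + ∑ i ∈ range n, X (i + 1) Qm k k' ≤ Xtot)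
    (h0 : ∀ Qm : TorusSite 2 L, ∀ k ∈ klBall L μ K, ∀ k' ∈ klBall L μ K,
      ‖klPairAmplitude L M β U μ K 0 Qm k k' - (U : ℂ)‖ ≤ initDevBar G U + X 0 Qm k k')
    (hsteps : ∀ j, 1 ≤ j → j ≤ n → ∀ Qm : TorusSite 2 L, IsPairClassAt L Qm j →
      ∃ w : TorusSite 2 L → ℝ, (∀ p, 0 ≤ w p) ∧ (∑ p, w p ≤ G.bhi) ∧
        ∃ N : Matrix (TorusSite 2 L) (TorusSite 2 L) ℂ,
          (1 + Matrix.diagonal (fun p => (w p : ℂ)) * klPairArray L M β U μ K (j - 1) Qm) * N = 1 ∧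
          ∀ k ∈ klBall L μ K, ∀ k' ∈ klBall L μ K,
            ‖klPairAmplitude L M β U μ K j Qm k k' - (klPairArray L M β U μ K (j - 1) Qm * N) k k'‖ ≤
              drivePBar G P U (j - 1) + eremBar G P Qc U β L (j - 1) + X j Qm k k')
    (hincr : ∀ j, 1 ≤ j → j ≤ n → ∀ Qm : TorusSite 2 L, ∀ k ∈ klBall L μ K, ∀ k' ∈ klBall L μ K,
      ‖klPairAmplitude L M β U μ K j Qm k k' - klPairAmplitude L M β U μ K (j - 1) Qm k k'‖ ≤
        gainBar G P U j (klTorusNorm L Qm) (klTorusNorm L (k - k')) (klTorusNorm L (k + k' - Qm)) +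
          eremBar G P Qc U β L (j - 1) + X j Qm k k')
    (Qm : TorusSite 2 L)
    (hsmall : 8 * 20 * ((initDevBar G U + ∑ j ∈ range n, (drivePBar G P U j + eremBar G P Qc U β L j) + Xtot) +
        (∑ j ∈ range n, (drivePBar G P U j + eremBar G P Qc U β L j) + Xsup)) * (G.bhi * n) ≤ 1) :
    ∃ u : ℝ, 0 ≤ u ∧ u ≤ U ∧ ∀ k ∈ klBall L μ K, ∀ k' ∈ klBall L μ K,
      ‖klPairAmplitude L M β U μ K n Qm k k' - (u : ℂ)‖ ≤
        8 * ((initDevBar G U + ∑ j ∈ range n, (drivePBar G P U j + eremBar G P Qc U β L j) + Xtot) +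
          (∑ j ∈ range n, (drivePBar G P U j + eremBar G P Qc U β L j) + Xsup)) +
        ((P.Klam * U) ^ 2 * (3 * G.CF) + Xtot + ∑ i ∈ range n, eremBar G P Qc U β L i) := by
  classical
  set τ : ℕ → ℝ := fun j => drivePBar G P U j + eremBar G P Qc U β L j with hτ
  have hτ0 : ∀ j, 0 ≤ τ j := fun j => add_nonneg (drivePBar_nonneg' hG U j) (eremBar_nonneg' hG hP hQc U β L j)
  have hbhi : 0 ≤ G.bhi := hG.2.2.1.trans hG.2.2.2.1
  have hCF : 0 ≤ G.CF := hG.2.2.2.2.2.2.2.2.2.2.2.2.2.1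
  have hinit0 : 0 ≤ initDevBar G U := by
    unfold initDevBar
    refine mul_nonneg (add_nonneg (sum_nonneg fun χ _ => add_nonneg (hG.2.1 χ) (hG.1 χ)) zero_le_one) (sq_nonneg U)
  have hSe0 : 0 ≤ ∑ i ∈ range n, eremBar G P Qc U β L i := sum_nonneg fun i _ => eremBar_nonneg' hG hP hQc U β L i
  have hg30 : 0 ≤ (P.Klam * U) ^ 2 * (3 * G.CF) := by positivity
  -- the extra term at this total momentum
  set Y : ℕ → TorusSite 2 L → TorusSite 2 L → ℝ := fun j k k' => X j Qm k k' with hY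
  -- the frozen part between two scales `t ≤ n` once the pair momentum is resolved at `t + 1`
  have hfrozen : ∀ t, t ≤ n → ((4 : ℝ) ^ (t + 1))⁻¹ < torusSupNorm (latticeMomentum L Qm 0, latticeMomentum L Qm 1) →
      ∀ k ∈ klBall L μ K, ∀ k' ∈ klBall L μ K,
        ‖klPairAmplitude L M β U μ K n Qm k k' - klPairAmplitude L M β U μ K t Qm k k'‖ ≤
          (P.Klam * U) ^ 2 * (3 * G.CF) + Xtot + ∑ i ∈ range n, eremBar G P Qc U β L i := by
    intro t htn hexit
    refine pairFrozen_increment_extra L M hG hP hQc htn Y (fun j hj hjn k hk k' hk' => ?_) (fun k _ k' _ => hXsum t Qm k k') hexit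
    have h := hincr j (by omega) hjn Qm k hk k' hk'
    simp only [klTorusNorm] at h
    simp only [hY]
    linarith
  by_cases hQ0 : IsPairClassAt L Qm 0
  · -- the last pair-class scale `t`
    set t : ℕ := Nat.findGreatest (fun s => IsPairClassAt L Qm s) n with ht_def
    have htn : t ≤ n := Nat.findGreatest_le n
    have hQt : IsPairClassAt L Qm t := Nat.findGreatest_spec (P := fun s => IsPairClassAt L Qm s) (Nat.zero_le n) hQ0
    have hSt : ∑ j ∈ range t, τ j ≤ ∑ j ∈ range n, τ j :=
      sum_le_sum_of_subset_of_nonneg (range_mono htn) fun j _ _ => hτ0 j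
    have hSt0 : 0 ≤ ∑ j ∈ range t, τ j := sum_nonneg fun j _ => hτ0 j
    -- the ladder data up to `t`
    have hsteps' : ∀ i < t, ∃ w : TorusSite 2 L → ℝ, (∀ p, 0 ≤ w p) ∧ (∑ p, w p ≤ G.bhi) ∧
        ∃ N : Matrix (TorusSite 2 L) (TorusSite 2 L) ℂ,
          (1 + Matrix.diagonal (fun p => (w p : ℂ)) * klPairArray L M β U μ K i Qm) * N = 1 ∧
          ∀ k ∈ klBall L μ K, ∀ k' ∈ klBall L μ K,
            ‖klPairAmplitude L M β U μ K (i + 1) Qm k k' - (klPairArray L M β U μ K i Qm * N) k k'‖ ≤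
              (drivePBar G P U i + eremBar G P Qc U β L i) + Y (i + 1) k k' := by
      intro i hi
      have h := hsteps (i + 1) (Nat.le_add_left 1 i) ((Nat.succ_le_of_lt hi).trans htn) Qm
        (isPairClassAt_mono L hQt (Nat.succ_le_of_lt hi))
      simp only [Nat.add_sub_cancel] at h
      obtain ⟨w, hw0, hwsum, N, hN, hb⟩ := h
      exact ⟨w, hw0, hwsum, N, hN, fun k hk k' hk' => by have := hb k hk k' hk'; simp only [hY]; linarith⟩
    have hXtot' : ∀ k k' : TorusSite 2 L, Y 0 k k' + ∑ i ∈ range t, Y (i + 1) k k' ≤ Xtot := fun k k' =>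
      (add_le_add le_rfl (sum_le_sum_of_subset_of_nonneg (range_mono htn) fun i _ _ => hX0 _ _ _ _)).trans (hXtot Qm k k')
    have hsmall' : 8 * 20 * ((initDevBar G U + ∑ j ∈ range t, τ j + Xtot) + (∑ j ∈ range t, τ j + Xsup)) * (G.bhi * t) ≤ 1 := by
      refine le_trans ?_ hsmall
      have ht' : (t : ℝ) ≤ n := by exact_mod_cast htn
      have h1 : (initDevBar G U + ∑ j ∈ range t, τ j + Xtot) + (∑ j ∈ range t, τ j + Xsup) ≤
          (initDevBar G U + ∑ j ∈ range n, τ j + Xtot) + (∑ j ∈ range n, τ j + Xsup) := by linarith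
      have hSn0 : 0 ≤ ∑ j ∈ range n, τ j := sum_nonneg fun j _ => hτ0 j
      have hX0' : 0 ≤ (initDevBar G U + ∑ j ∈ range n, τ j + Xtot) + (∑ j ∈ range n, τ j + Xsup) := by linarith
      exact mul_le_mul (mul_le_mul_of_nonneg_left h1 (by norm_num)) (mul_le_mul_of_nonneg_left ht' hbhi)
        (mul_nonneg hbhi (Nat.cast_nonneg t)) (mul_nonneg (by norm_num) hX0')
    obtain ⟨u, hu0, huU, hu⟩ := pairLadder_envelope_extra0 L M hG hP hQc hU (n := t) (Qm := Qm) Y (fun j k k' => hX0 j Qm k k')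
      (fun i _ k k' => hXsup (i + 1) Qm k k') hXtot' hXtot0 hXsup0 (fun k hk k' hk' => h0 Qm k hk k' hk') hsteps' hsmall'
    refine ⟨u, hu0, huU, fun k hk k' hk' => ?_⟩
    have hfro : ‖klPairAmplitude L M β U μ K n Qm k k' - klPairAmplitude L M β U μ K t Qm k k'‖ ≤
        (P.Klam * U) ^ 2 * (3 * G.CF) + Xtot + ∑ i ∈ range n, eremBar G P Qc U β L i := by
      rcases htn.eq_or_lt with h | h
      · rw [h, sub_self, norm_zero]
        linarith [hSe0, hg30]
      · have hnot : ¬ IsPairClassAt L Qm (t + 1) :=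
          Nat.findGreatest_is_greatest (P := fun s => IsPairClassAt L Qm s) (Nat.lt_succ_self t) (Nat.succ_le_of_lt h)
        exact hfrozen t htn (lt_of_not_ge hnot) k hk k' hk'
    have hlad := hu k hk k' hk'
    calc ‖klPairAmplitude L M β U μ K n Qm k k' - (u : ℂ)‖
        ≤ ‖klPairAmplitude L M β U μ K t Qm k k' - (u : ℂ)‖ +
            ‖klPairAmplitude L M β U μ K n Qm k k' - klPairAmplitude L M β U μ K t Qm k k'‖ := by
          rw [show klPairAmplitude L M β U μ K n Qm k k' - (u : ℂ) =
            (klPairAmplitude L M β U μ K t Qm k k' - (u : ℂ)) +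
              (klPairAmplitude L M β U μ K n Qm k k' - klPairAmplitude L M β U μ K t Qm k k') by ring]
          exact norm_add_le _ _
      _ ≤ _ := by
          refine (add_le_add hlad hfro).trans ?_
          simp only [hτ] at hSt ⊢
          nlinarith [hSt, hinit0, hSt0, hXtot0, hXsup0]
  · -- never in the pair class: frozen from scale 0 around the bare value `U`
    have hexit : ((4 : ℝ) ^ (0 + 1))⁻¹ < torusSupNorm (latticeMomentum L Qm 0, latticeMomentum L Qm 1) := by
      have h1 : ¬ torusSupNorm (latticeMomentum L Qm 0, latticeMomentum L Qm 1) ≤ ((4 : ℝ) ^ 0)⁻¹ := hQ0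
      push Not at h1
      exact lt_trans (by norm_num) h1
    refine ⟨U, hU, le_rfl, fun k hk k' hk' => ?_⟩
    have hfro := hfrozen 0 (Nat.zero_le n) hexit k hk k' hk'
    have h0' := h0 Qm k hk k' hk'
    have hX0le : X 0 Qm k k' ≤ Xtot :=
      (le_add_of_nonneg_right (sum_nonneg fun i _ => hX0 (i + 1) Qm k k')).trans (hXtot Qm k k')
    have hS0 : 0 ≤ ∑ j ∈ range n, τ j := sum_nonneg fun j _ => hτ0 j
    calc ‖klPairAmplitude L M β U μ K n Qm k k' - (U : ℂ)‖
        ≤ ‖klPairAmplitude L M β U μ K n Qm k k' - klPairAmplitude L M β U μ K 0 Qm k k'‖ +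
            ‖klPairAmplitude L M β U μ K 0 Qm k k' - (U : ℂ)‖ := by
          rw [show klPairAmplitude L M β U μ K n Qm k k' - (U : ℂ) =
            (klPairAmplitude L M β U μ K n Qm k k' - klPairAmplitude L M β U μ K 0 Qm k k') +
              (klPairAmplitude L M β U μ K 0 Qm k k' - (U : ℂ)) by ring]
          exact norm_add_le _ _
      _ ≤ _ := by
          refine (add_le_add hfro h0').trans ?_
          simp only [hτ] at hS0
          nlinarith [hS0, hinit0, hXtot0, hXsup0, hX0le]

end Model

end Summit.HubbardSuperconductivity.HubbardSuperconductivity.Theorems.KLRegimeSplit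

end
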